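import Mathlib
import Literature.Probability.Percolation.KozmaNitzanGoodQuadruple
import Literature.Probability.LatticeModels.ProdBernoulliIndependence
import HarnessLib

/-!
# `NoHeavyLowerTail` (stmt-CriticalPhenomena-4575), line fat-minority-linear — the BRIDGE CRITERION
# (Kozma–Nitzan's Question 9 at depth 2 for a glued block: the union/bridge bookkeeping)

Route task `nh-dp-fatminority` (gen 7).  Observer `o` glued by weight-`1` pairs to its units `X` (its only
positive pairs), every unit adjacent only to the relays `A` (and to `o`), `b, a ∈ A`, `a` a minimiser over
`A` of `P_{G∖o}(· ↔ b)` (the anchor of Question 9).  Write `Γ' = G ∖ o` (`restrW {o}ᶜ w`), `x ∈ X` a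
distinguished unit and `Y = X ∖ {x}`.  Two facts turn the glued block into bookkeeping inside `Γ'`:
  (I1) `o ↔ b` iff some unit reaches `b` in `Γ'`;
  (I2) `a ↔ b` in `G` iff `a ↔ b` in `Γ'` or there is a BRIDGE through `o`: `a ↔ u`, `v ↔ b` in `Γ'`
       for two units `u ≠ v` (first and last visit of an `a–b` path to `o`).
With Kozma–Nitzan's Theorem 4 for the star `x` of `Γ'` in the pre-FKG form WITH THE ANCHOR `a`
(`P_{Γ'}(x ↔ b) ≥ P_{Γ'}(a ↔ b, x attached)`), (I1)–(I2) give
* `twoSided_bridgeCriterion`: if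
  `P_{Γ'}(a ↔ b, x unattached, Y attached) + P_{Γ'}(a ↮ b, bridge) ≤ P_{Γ'}(Y ↔ b, x ↮ b)`      (H_x)
  then `P(a ↔ b, o ↔ A) ≤ P(o ↔ b)` — Question 9 / GOOD2 for the block with the FIXED anchor `a`
  (`…_bad_le`: `μ(o ↔ A, o ↮ b) ≤ μ(o ↔ A, a ↮ b) ≤ μ(a ↮ b)`).
Numerically (gen 7) `H_x` holds for some unit `x` in ≈ 99 % of random instances and in EVERY instance that is
not already settled by Lemma 5 / `P_G(a b) ≤ P_G(o b)` / the sub-fan anchors (77/77 mined ones), and the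
union of these criteria has no known exception (`FINDINGS-fat-minority-gen7.md` §7).  No new definitions.
[cite: KozmaNitzan2024, §3.2 Theorem 4 (p. 12), Lemma 5 (p. 13), Question 9 (p. 36)]
-/

namespace Summit.CriticalPhenomena.PercolationContinuityZ3.Theorems

open MeasureTheory Set
open Literature.Probability.LatticeModels (prodBernoulli prodBernoulli_real_setOf_mem prodBernoulli_real_setOf_notMem)
open Literature.Probability.Percolation
open Literature.Probability.Percolation.KNGoodAux

noncomputable section
open Classical

variable {V : Type*} [Fintype V]

/-- **A good quadruple satisfies (2) with a PRESCRIBED minimiser.**  If `(G, A, 0, b)` is good and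
`a₀ ∈ A` minimises `P(· ↔ b)` over `A`, then `P(a₀ ↔ b, 0 ↔ A) ≤ P(0 ↔ b)` (the tree's
`KNGood.preFKG2` with the minimiser exposed). [cite: KozmaNitzan2024, §3.2 p. 12 (a good graph satisfies (2))] -/
theorem knGood_preFKG2_of_min [DecidableEq V] {w : Sym2 V → unitInterval} {A : Finset V}
    {hA : A.Nonempty} {o b : V} (h : KNGood w A hA o b) {a₀ : V} (ha₀ : a₀ ∈ A)
    (hmin : ∀ v ∈ A, (prodBernoulli w).real (openConn a₀ b) ≤ (prodBernoulli w).real (openConn v b)) :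
    (prodBernoulli w).real (openConn a₀ b ∩ ⋃ a' ∈ A, openConn o a') ≤
      (prodBernoulli w).real (openConn o b) := by
  classical
  set μ := prodBernoulli w with hμ
  have hinf : A.inf' hA (fun a => μ.real (openConn a b)) = μ.real (openConn a₀ b) :=
    le_antisymm (Finset.inf'_le _ ha₀) ((Finset.le_inf'_iff hA _).2 hmin)
  have hcorr : ∑ W ∈ nullSets A, μ.real (clusterIs o W) *
        A.inf' hA (fun a => μ.real (openConnIn ((↑W : Set V)ᶜ) a b)) ≤
      μ.real ({ω | ∀ a ∈ A, ¬ (openGraph ω).Reachable o a} ∩ openConn a₀ b) := by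
    rw [← sum_real_clusterIs_inter w A o]
    refine Finset.sum_le_sum fun W hW => ?_
    have ha₀W : a₀ ∉ W := fun h' => Finset.disjoint_left.1 (mem_nullSets.1 hW) h' ha₀
    rw [real_clusterIs_inter_openConn w o W ha₀W b]
    exact mul_le_mul_of_nonneg_left (Finset.inf'_le _ ha₀) measureReal_nonneg
  have hsplit : μ.real (openConn a₀ b) = μ.real (openConn a₀ b ∩ ⋃ a' ∈ A, openConn o a') +
      μ.real ({ω | ∀ a ∈ A, ¬ (openGraph ω).Reachable o a} ∩ openConn a₀ b) := by
    rw [inter_comm {ω | ∀ a ∈ A, ¬ (openGraph ω).Reachable o a}, ← measureReal_inter_add_sdiff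
      (s := (openConn a₀ b : Set (BondConfig V)))
      (MeasurableSet.of_discrete : MeasurableSet (⋃ a' ∈ A, (openConn o a' : Set (BondConfig V))))]
    congr 1
    congr 1
    ext ω
    simp only [mem_sdiff, mem_iUnion, exists_prop, not_exists, not_and, mem_inter_iff, mem_setOf_eq]
    exact ⟨fun ⟨h1, h2⟩ => ⟨h1, h2⟩, fun ⟨h1, h2⟩ => ⟨h1, h2⟩⟩
  have hg : A.inf' hA (fun a => μ.real (openConn a b)) -
      ∑ W ∈ nullSets A, μ.real (clusterIs o W) *
        A.inf' hA (fun a => μ.real (openConnIn ((↑W : Set V)ᶜ) a b)) ≤ μ.real (openConn o b) := h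
  rw [hinf] at hg
  linarith

omit [Fintype V] in
/-- **Last visit to `o`.**  An open path from `u` to `c ≠ o` either avoids `o` (and then `u ≠ o`), or after
its last visit to `o` it leaves through an open pair `s(o,v)` and continues to `c` off `o`. [folklore] -/
theorem lastVisit_or_offVertex {ω : BondConfig V} (o : V) {u c : V} (hco : c ≠ o)
    (h : (openGraph ω).Reachable u c) :
    (u ≠ o ∧ ω ∈ openConnIn ({o}ᶜ : Set V) u c) ∨
      ∃ v : V, v ≠ o ∧ s(o, v) ∈ ω ∧ ω ∈ openConnIn ({o}ᶜ : Set V) v c := by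
  obtain ⟨p⟩ := h
  induction p with
  | nil => exact Or.inl ⟨hco, KNPreFKG.openConnIn_rfl (mem_compl_singleton_iff.2 hco) ω⟩
  | @cons u u₁ c' hadj p ih =>
    rcases ih hco with ⟨hu₁o, hconn⟩ | hright
    · by_cases huo : u = o
      · subst huo
        exact Or.inr ⟨u₁, hu₁o, ((openGraph_adj ω u u₁).1 hadj).1, hconn⟩
      · exact Or.inl ⟨huo, KNPreFKG.openConnIn_trans
          (KNPreFKG.openConnIn_of_adj (mem_compl_singleton_iff.2 huo) (mem_compl_singleton_iff.2 hu₁o) hadj)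
          hconn⟩
    · exact Or.inr hright

/-- **Bridge criterion for a glued block (Question 9 at depth 2 with the fixed anchor `a`).**
`o ∉ A ∪ X`, `X ∩ A = ∅`, `x ∈ X`, `b, a ∈ A`; `o`'s pairs to `X` have weight `1` and `o` has no other
positive pair; units are attached only to `A ∪ {o}`; `a` minimises `P_{Γ'}(· ↔ b)` over `A`,
`Γ' = restrW {o}ᶜ w`.  If
`P_{Γ'}(a ↔ b, x unattached, some y ∈ X∖{x} attached) + P_{Γ'}(a ↮ b, ∃ u ≠ v ∈ X: a ↔ u ∧ v ↔ b)`
`  ≤ P_{Γ'}(∃ y ∈ X∖{x}: y ↔ b, x ↮ b)`,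
then `P(a ↔ b, o ↔ A) ≤ P(o ↔ b)`.
[cite: KozmaNitzan2024, §3.2 Theorem 4 (p. 12), Lemma 5 (p. 13), Question 9 (p. 36)] -/
theorem twoSided_bridgeCriterion [DecidableEq V] (w : Sym2 V → unitInterval) (X A : Finset V)
    (o x a b : V) (hoX : o ∉ X) (hoA : o ∉ A) (hXA : Disjoint X A) (hx : x ∈ X) (hb : b ∈ A) (ha : a ∈ A)
    (hstar : ∀ u ∈ X, w s(o, u) = 1)
    (hstar0 : ∀ u : V, u ≠ o → u ∉ X → w s(o, u) = 0)
    (hunit : ∀ u ∈ X, ∀ z : V, z ≠ o → z ∉ A → w s(u, z) = 0)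
    (hmin : ∀ v ∈ A, (prodBernoulli (restrW ({o}ᶜ : Set V) w)).real (openConn a b) ≤
      (prodBernoulli (restrW ({o}ᶜ : Set V) w)).real (openConn v b))
    (hH : (prodBernoulli (restrW ({o}ᶜ : Set V) w)).real
        (openConn a b ∩ {ω | ∀ c ∈ A, s(x, c) ∉ ω} ∩ {ω | ∃ y ∈ X, y ≠ x ∧ ∃ c ∈ A, s(y, c) ∈ ω}) +
      (prodBernoulli (restrW ({o}ᶜ : Set V) w)).real
        ((openConn a b)ᶜ ∩ ⋃ u ∈ X, ⋃ v ∈ X.erase u, (openConn a u ∩ openConn v b)) ≤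
      (prodBernoulli (restrW ({o}ᶜ : Set V) w)).real
        ((⋃ y ∈ X.erase x, openConn y b) ∩ (openConn x b)ᶜ)) :
    (prodBernoulli w).real (openConn a b ∩ ⋃ c ∈ A, openConn o c) ≤
      (prodBernoulli w).real (openConn o b) := by
  set μ := prodBernoulli w with hμ
  set w' := restrW ({o}ᶜ : Set V) w with hw'
  set μ' := prodBernoulli w' with hμ'
  set S : Set V := ({o}ᶜ : Set V) with hS
  have hmeas : ∀ E : Set (BondConfig V), MeasurableSet E := fun _ => MeasurableSet.of_discrete
  have hA : A.Nonempty := ⟨b, hb⟩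
  have hbo : b ≠ o := fun h => hoA (h ▸ hb)
  have hao : a ≠ o := fun h => hoA (h ▸ ha)
  have hxo : x ≠ o := fun h => hoX (h ▸ hx)
  have hxA : x ∉ A := fun h => Finset.disjoint_left.1 hXA hx h
  have hXo : ∀ u ∈ X, u ≠ o := fun u hu h => hoX (h ▸ hu)
  have hXnA : ∀ u ∈ X, u ∉ A := fun u hu h => Finset.disjoint_left.1 hXA hu h
  -- events
  set AttOf : V → Set (BondConfig V) := fun u => {ω | ∃ c ∈ A, s(u, c) ∈ ω} with hAttOf
  set E1 : Set (BondConfig V) := openConn a b ∩ AttOf x with hE1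
  set E2 : Set (BondConfig V) :=
    openConn a b ∩ {ω | ∀ c ∈ A, s(x, c) ∉ ω} ∩ {ω | ∃ y ∈ X, y ≠ x ∧ ∃ c ∈ A, s(y, c) ∈ ω} with hE2
  set E3 : Set (BondConfig V) :=
    (openConn a b)ᶜ ∩ ⋃ u ∈ X, ⋃ v ∈ X.erase u, (openConn a u ∩ openConn v b) with hE3
  set F : Set (BondConfig V) := (⋃ y ∈ X.erase x, openConn y b) ∩ (openConn x b)ᶜ with hF
  -- the cut-down configuration and the transfer `P_{Γ'}(E) = P(ω ∩ wireSet S ∈ E)`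
  have htrans : ∀ E : Set (BondConfig V), μ'.real E = μ.real {ω | ω ∩ wireSet S ∈ E} :=
    fun E => restrW_real_eq w S E
  have hconn_iff : ∀ {p q : V} (ω : BondConfig V), p ≠ o →
      (ω ∩ wireSet S ∈ (openConn p q : Set (BondConfig V)) ↔ ω ∈ openConnIn S p q) :=
    fun {p q} ω hp => inter_wireSet_mem_openConn_iff (mem_compl_singleton_iff.2 hp) q
  have hpair_iff : ∀ {u c : V} (ω : BondConfig V), u ≠ o → c ≠ o → u ≠ c →
      (s(u, c) ∈ ω ∩ wireSet S ↔ s(u, c) ∈ ω) := by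
    intro u c ω huo hco huc
    refine ⟨fun h => h.1, fun h => ⟨h, mk_mem_wireSet_iff.2 ⟨mem_compl_singleton_iff.2 huo,
      mem_compl_singleton_iff.2 hco, huc⟩⟩⟩
  -- the null set: a star pair closed or a weight-zero pair open
  set Z : Finset (Sym2 V) := Finset.univ.filter fun e : Sym2 V => w e = 0 with hZ
  set N : Set (BondConfig V) :=
    {ω | ∃ u ∈ X, s(o, u) ∉ ω} ∪ ⋃ e ∈ Z, {ω : BondConfig V | e ∈ ω} with hN
  have hN0 : μ.real N = 0 := by
    have h1 : μ.real {ω : BondConfig V | ∃ u ∈ X, s(o, u) ∉ ω} = 0 := by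
      have hsub : {ω : BondConfig V | ∃ u ∈ X, s(o, u) ∉ ω} ⊆ ⋃ u ∈ X, {ω | s(o, u) ∉ ω} := by
        intro ω hω
        obtain ⟨u, hu, huω⟩ := hω
        exact Set.mem_iUnion₂.2 ⟨u, hu, huω⟩
      refine le_antisymm ((measureReal_mono hsub (measure_ne_top _ _)).trans
        ((measureReal_biUnion_finset_le X _).trans (le_of_eq ?_))) measureReal_nonneg
      refine Finset.sum_eq_zero fun u hu => ?_
      rw [hμ, prodBernoulli_real_setOf_notMem, hstar u hu]
      simp
    have h2 : μ.real (⋃ e ∈ Z, {ω : BondConfig V | e ∈ ω}) = 0 := by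
      refine le_antisymm ((measureReal_biUnion_finset_le Z _).trans (le_of_eq ?_)) measureReal_nonneg
      refine Finset.sum_eq_zero fun e he => ?_
      rw [hμ, prodBernoulli_real_setOf_mem, (Finset.mem_filter.1 he).2]
      rfl
    refine le_antisymm ((measureReal_union_le _ _).trans (by rw [h1, h2, add_zero])) measureReal_nonneg
  have hnullE : ∀ E E' : Set (BondConfig V), E ∩ Nᶜ ⊆ E' → μ.real E ≤ μ.real E' := by
    intro E E' h
    calc μ.real E ≤ μ.real ((E ∩ Nᶜ) ∪ N) := measureReal_mono (fun ω hω => by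
            by_cases hn : ω ∈ N
            · exact Or.inr hn
            · exact Or.inl ⟨hω, hn⟩) (measure_ne_top _ _)
      _ ≤ μ.real (E ∩ Nᶜ) + μ.real N := measureReal_union_le _ _
      _ ≤ μ.real E' := by rw [hN0, add_zero]; exact measureReal_mono h (measure_ne_top _ _)
  -- consequences of `ω ∉ N`
  have hopen_pos : ∀ {ω : BondConfig V}, ω ∉ N → ∀ e : Sym2 V, e ∈ ω → w e ≠ 0 := by
    intro ω hω e he h0
    exact hω (Or.inr (Set.mem_iUnion₂.2 ⟨e, Finset.mem_filter.2 ⟨Finset.mem_univ _, h0⟩, he⟩))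
  have hstar_open : ∀ {ω : BondConfig V}, ω ∉ N → ∀ u ∈ X, s(o, u) ∈ ω := by
    intro ω hω u hu
    by_contra h
    exact hω (Or.inl ⟨u, hu, h⟩)
  have hnbr_X : ∀ {ω : BondConfig V}, ω ∉ N → ∀ v : V, v ≠ o → s(o, v) ∈ ω → v ∈ X := by
    intro ω hω v hvo hv
    by_contra hvX
    exact hopen_pos hω _ hv (hstar0 v hvo hvX)
  -- a unit joined off `o` to another vertex is attached
  have hunit_att : ∀ {ω : BondConfig V}, ω ∉ N → ∀ u ∈ X, ∀ c : V, u ≠ c →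
      ω ∈ openConnIn S u c → ∃ c' ∈ A, s(u, c') ∈ ω := by
    intro ω hω u hu c huc hconn
    rw [DCT16.mem_openConnIn_iff_pathIn] at hconn
    obtain ⟨_, hr⟩ := hconn
    rcases hr.cases_head with h | ⟨z, ⟨hadj, hzS⟩, _⟩
    · exact absurd h huc
    · obtain ⟨huz, hne⟩ := (openGraph_adj ω u z).1 hadj
      have hzo : z ≠ o := mem_compl_singleton_iff.1 hzS
      by_cases hzA : z ∈ A
      · exact ⟨z, hzA, huz⟩
      · exact absurd (hunit u hu z hzo hzA) (hopen_pos hω _ huz)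
  -- symmetry of `↔ in S`
  have hsymm : ∀ {p q : V} {ω : BondConfig V}, ω ∈ openConnIn S p q → ω ∈ openConnIn S q p := by
    intro p q ω h
    obtain ⟨hp, hq, hr⟩ := h
    exact ⟨hq, hp, hr.symm⟩
  /- Step C: `{a ↔ b, o ↔ A} ∖ N ⊆ {ω | ω ∩ wireSet S ∈ E1 ∪ E2 ∪ E3}`. -/
  have hC : (openConn a b ∩ ⋃ c ∈ A, openConn o c) ∩ Nᶜ ⊆
      {ω | ω ∩ wireSet S ∈ E1} ∪ {ω | ω ∩ wireSet S ∈ E2} ∪ {ω | ω ∩ wireSet S ∈ E3} := by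
    rintro ω ⟨⟨hab, hoA'⟩, hωN⟩
    have hωN' : ω ∉ N := hωN
    by_cases hab' : ω ∈ openConnIn S a b
    · -- some unit is attached
      obtain ⟨c, hc, hoc⟩ := Set.mem_iUnion₂.1 hoA'
      have hco : c ≠ o := fun h => hoA (h ▸ hc)
      rcases lastVisit_or_offVertex o hco hoc with ⟨hoo, _⟩ | ⟨v, hvo, hov, hvc⟩
      · exact absurd rfl hoo
      have hvX : v ∈ X := hnbr_X hωN' v hvo hov
      have hvc' : v ≠ c := fun h => hXnA v hvX (h ▸ hc)
      obtain ⟨c', hc', hvc''⟩ := hunit_att hωN' v hvX c hvc' hvc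
      have habw : ω ∩ wireSet S ∈ (openConn a b : Set (BondConfig V)) := (hconn_iff ω hao).2 hab'
      by_cases hxatt : ∃ d ∈ A, s(x, d) ∈ ω
      · left; left
        obtain ⟨d, hd, hxd⟩ := hxatt
        exact ⟨habw, d, hd, (hpair_iff ω hxo (fun h => hoA (h ▸ hd)) (fun h => hxA (h ▸ hd))).2 hxd⟩
      · left; right
        have hvx : v ≠ x := by
          rintro rfl
          exact hxatt ⟨c', hc', hvc''⟩
        refine ⟨⟨habw, fun d hd hxd => hxatt ⟨d, hd, (hpair_iff ω hxo (fun h => hoA (h ▸ hd))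
          (fun h => hxA (h ▸ hd))).1 hxd⟩⟩, v, hvX, hvx, c', hc', ?_⟩
        exact (hpair_iff ω hvo (fun h => hoA (h ▸ hc')) (fun h => hXnA v hvX (h ▸ hc'))).2 hvc''
    · -- a bridge through `o`
      right
      rcases lastVisit_or_offVertex o hbo hab with ⟨_, h⟩ | ⟨v, hvo, hov, hvb⟩
      · exact absurd h hab'
      rcases lastVisit_or_offVertex o hao hab.symm with ⟨_, h⟩ | ⟨u, huo, hou, hua⟩
      · exact absurd (hsymm h) hab'
      have hvX : v ∈ X := hnbr_X hωN' v hvo hov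
      have huX : u ∈ X := hnbr_X hωN' u huo hou
      have hau : ω ∈ openConnIn S a u := hsymm hua
      have huv : v ≠ u := by
        rintro rfl
        exact hab' (KNPreFKG.openConnIn_trans hau hvb)
      refine ⟨fun h => hab' ((hconn_iff ω hao).1 h), Set.mem_iUnion₂.2 ⟨u, huX, Set.mem_iUnion₂.2
        ⟨v, Finset.mem_erase.2 ⟨huv, hvX⟩, (hconn_iff ω hao).2 hau, (hconn_iff ω hvo).2 hvb⟩⟩⟩
  /- Step D: `{ω | ω ∩ wireSet S ∈ {x ↔ b} ∪ F} ∖ N ⊆ {o ↔ b}`. -/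
  have hD : {ω | ω ∩ wireSet S ∈ (openConn x b : Set (BondConfig V)) ∪ F} ∩ Nᶜ ⊆ openConn o b := by
    rintro ω ⟨hω, hωN⟩
    have hωN' : ω ∉ N := hωN
    have key : ∀ u ∈ X, ω ∩ wireSet S ∈ (openConn u b : Set (BondConfig V)) → ω ∈ openConn o b := by
      intro u hu hub
      have hub' : ω ∈ openConnIn S u b := (hconn_iff ω (hXo u hu)).1 hub
      have hou : (openGraph ω).Adj o u := (openGraph_adj ω o u).2 ⟨hstar_open hωN' u hu, (hXo u hu).symm⟩
      exact hou.reachable.trans (KNPreFKG.reachable_of_openConnIn hub')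
    rcases hω with hxb | ⟨hYb, _⟩
    · exact key x hx hxb
    · obtain ⟨y, hy, hyb⟩ := Set.mem_iUnion₂.1 hYb
      exact key y (Finset.mem_of_mem_erase hy) hyb
  /- Step A: Theorem 4 for the star `x` of `Γ'`, pre-FKG form with the anchor `a`. -/
  have hgood : KNGood w' A hA x b := by
    refine KozmaNitzan2024_thm4_good w' A hA x b hxA fun u hux huA => ?_
    by_cases huo : u = o
    · subst huo
      exact restrW_apply_of_not_mem w fun h => (mk_mem_wireSet_iff.1 h).2.1 rfl
    · exact le_antisymm ((restrW_le _ w s(x, u)).trans (hunit x hx u huo huA).le) bot_le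
  have hA4 : μ'.real (openConn a b ∩ ⋃ c ∈ A, openConn x c) ≤ μ'.real (openConn x b) :=
    knGood_preFKG2_of_min hgood ha hmin
  have hE1 : μ'.real E1 ≤ μ'.real (openConn x b) := by
    refine le_trans (measureReal_mono (fun ω hω => ?_) (measure_ne_top _ _)) hA4
    obtain ⟨hab, c, hc, hxc⟩ := hω
    have hxc' : x ≠ c := fun h => hxA (h ▸ hc)
    exact ⟨hab, Set.mem_iUnion₂.2 ⟨c, hc, ((openGraph_adj ω x c).2 ⟨hxc, hxc'⟩).reachable⟩⟩
  /- Assembly. -/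
  have hdisj : Disjoint (openConn x b : Set (BondConfig V)) F :=
    Set.disjoint_left.2 fun ω hxb hF => hF.2 hxb
  calc μ.real (openConn a b ∩ ⋃ c ∈ A, openConn o c)
      ≤ μ.real ({ω | ω ∩ wireSet S ∈ E1} ∪ {ω | ω ∩ wireSet S ∈ E2} ∪ {ω | ω ∩ wireSet S ∈ E3}) :=
        hnullE _ _ hC
    _ ≤ μ.real {ω | ω ∩ wireSet S ∈ E1} + μ.real {ω | ω ∩ wireSet S ∈ E2} +
          μ.real {ω | ω ∩ wireSet S ∈ E3} := by
        have h12 := measureReal_union_le (μ := μ) {ω | ω ∩ wireSet S ∈ E1} {ω | ω ∩ wireSet S ∈ E2}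
        have h123 := measureReal_union_le (μ := μ)
          ({ω | ω ∩ wireSet S ∈ E1} ∪ {ω | ω ∩ wireSet S ∈ E2}) {ω | ω ∩ wireSet S ∈ E3}
        linarith
    _ = μ'.real E1 + μ'.real E2 + μ'.real E3 := by rw [htrans E1, htrans E2, htrans E3]
    _ ≤ μ'.real (openConn x b) + μ'.real F := by linarith [hE1, hH]
    _ = μ'.real ((openConn x b : Set (BondConfig V)) ∪ F) := (measureReal_union hdisj (hmeas F)).symm
    _ = μ.real {ω | ω ∩ wireSet S ∈ (openConn x b : Set (BondConfig V)) ∪ F} := htrans _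
    _ ≤ μ.real (openConn o b) := hnullE _ _ hD

/-- **Bridge criterion, `bad` form**: under the hypotheses of `twoSided_bridgeCriterion`,
`μ(o ↔ A, o ↮ b) ≤ μ(o ↔ A, a ↮ b) ≤ μ(a ↮ b)` (linear gluing with constant `1`).
[cite: KozmaNitzan2024, §3.2 Theorem 4 (p. 12), Question 9 (p. 36)] -/
theorem twoSided_bridgeCriterion_bad_le [DecidableEq V] (w : Sym2 V → unitInterval) (X A : Finset V)
    (o x a b : V) (hoX : o ∉ X) (hoA : o ∉ A) (hXA : Disjoint X A) (hx : x ∈ X) (hb : b ∈ A) (ha : a ∈ A)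
    (hstar : ∀ u ∈ X, w s(o, u) = 1)
    (hstar0 : ∀ u : V, u ≠ o → u ∉ X → w s(o, u) = 0)
    (hunit : ∀ u ∈ X, ∀ z : V, z ≠ o → z ∉ A → w s(u, z) = 0)
    (hmin : ∀ v ∈ A, (prodBernoulli (restrW ({o}ᶜ : Set V) w)).real (openConn a b) ≤
      (prodBernoulli (restrW ({o}ᶜ : Set V) w)).real (openConn v b))
    (hH : (prodBernoulli (restrW ({o}ᶜ : Set V) w)).real
        (openConn a b ∩ {ω | ∀ c ∈ A, s(x, c) ∉ ω} ∩ {ω | ∃ y ∈ X, y ≠ x ∧ ∃ c ∈ A, s(y, c) ∈ ω}) +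
      (prodBernoulli (restrW ({o}ᶜ : Set V) w)).real
        ((openConn a b)ᶜ ∩ ⋃ u ∈ X, ⋃ v ∈ X.erase u, (openConn a u ∩ openConn v b)) ≤
      (prodBernoulli (restrW ({o}ᶜ : Set V) w)).real
        ((⋃ y ∈ X.erase x, openConn y b) ∩ (openConn x b)ᶜ)) :
    (prodBernoulli w).real ((⋃ c ∈ A, openConn o c) ∩ (openConn o b)ᶜ) ≤
      (prodBernoulli w).real (openConn a b)ᶜ := by
  set μ := prodBernoulli w with hμ
  have hmeas : ∀ E : Set (BondConfig V), MeasurableSet E := fun _ => MeasurableSet.of_discrete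
  have h := twoSided_bridgeCriterion w X A o x a b hoX hoA hXA hx hb ha hstar hstar0 hunit hmin hH
  have hob : openConn o b ⊆ ⋃ c ∈ A, (openConn o c : Set (BondConfig V)) :=
    fun ω hω => Set.mem_iUnion₂.2 ⟨b, hb, hω⟩
  -- `μ(U ∖ {o↔b}) = μ(U) − μ(o↔b) ≤ μ(U) − μ(a↔b ∩ U) = μ(U ∖ {a↔b}) ≤ μ({a↔b}ᶜ)`
  have h1 := measureReal_inter_add_sdiff (μ := μ) (s := ⋃ c ∈ A, (openConn o c : Set (BondConfig V)))
    (t := openConn o b) (hmeas _) (measure_ne_top _ _)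
  have h2 := measureReal_inter_add_sdiff (μ := μ) (s := ⋃ c ∈ A, (openConn o c : Set (BondConfig V)))
    (t := openConn a b) (hmeas _) (measure_ne_top _ _)
  rw [Set.inter_eq_right.2 hob] at h1
  rw [Set.inter_comm] at h2
  rw [Set.sdiff_eq] at h1 h2
  calc μ.real ((⋃ c ∈ A, openConn o c) ∩ (openConn o b)ᶜ)
      ≤ μ.real ((⋃ c ∈ A, openConn o c) ∩ (openConn a b)ᶜ) := by linarith
    _ ≤ μ.real (openConn a b)ᶜ := measureReal_mono Set.inter_subset_right (measure_ne_top _ _)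

end

end Summit.CriticalPhenomena.PercolationContinuityZ3.Theorems
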